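import Literature.AlgebraicGeometry.Motives.CyclesAbelianVarieties
import Literature.AlgebraicGeometry.Motives.VarietiesDimensionProofs
import HarnessLib

/-!
# The top Chow group of a smooth projective variety; discharge of
`Literature.AlgebraicGeometry.Motives.nonempty_chowGroup_top_equiv_int` and `Literature.AlgebraicGeometry.Motives.exists_chowGroup_top_equiv_int`

`Literature.AlgebraicGeometry.Motives.CyclesAbelianVarieties` records as named facts (hodge.S10)

* `Literature.AlgebraicGeometry.Motives.nonempty_chowGroup_top_equiv_int`: for a smooth projective geometrically integral
  variety `X` of dimension `n` over a field `k`, `CH_n X ≅ ℤ`;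
* `Literature.AlgebraicGeometry.Motives.exists_chowGroup_top_equiv_int`: there is such an isomorphism sending the class of
  every `n`-dimensional point (i.e. the fundamental class `[X]`) to `1`.

Both are the one-component case of Fulton, *Intersection Theory*, §1.3, Example 1.3.2: *if `X`
is `n`-dimensional, `A_n X = Z_n X` is the free abelian group on the `n`-dimensional irreducible
components of `X`* ("a cycle of the form `[div(r)]`, `r ∈ R(W)^*`, cannot include an irreducible
component of `X`", `W` being `(n + 1)`-dimensional). This file proves them
(`Literature.AlgebraicGeometry.Motives.exists_chowGroup_top_equiv_int_holds`,
`Literature.AlgebraicGeometry.Motives.nonempty_chowGroup_top_equiv_int_holds`), following exactly that argument in the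
dimension-graded set-up of `Literature.AlgebraicGeometry.Motives.Cycles` (a point `z` of the
scheme stands for the closed integral subscheme `closure {z}`, of dimension `Order.height z` in
the specialisation order `a ≤ b ↔ b ⤳ a`):

1. `X` is irreducible (geometrically irreducible over the point `Spec k`, Mathlib
   `GeometricallyIrreducible.irreducibleSpace_of_subsingleton`) and has topological Krull
   dimension `n` (`Literature.AlgebraicGeometry.Motives.topologicalKrullDim_eq_of_smoothOfRelativeDimension`, the dimension theory
   of `Motives/VarietiesDimensionProofs`; Görtz–Wedhorn I, Lemma 6.26 with Lemma 5.7 (4)).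
2. Hence the generic point `η` of `X` has `height η = n` (`IsSmoothProjective.height_genericPoint`),
   every other point has height `< n` (`height z + 1 ≤ height η`), and no point has height
   `n + 1`: the generic point is the unique point of dimension `n`
   (`IsSmoothProjective.height_eq_iff`) and there is none of dimension `n + 1`.
3. So `Rat_n X = ⊥` (`IsSmoothProjective.ratTrivial_eq_bot`: its generators are indexed by
   closed subvarieties `W` with `W.dim = height W.genericPoint = n + 1`), an `n`-cycle is
   determined by its coefficient at `η` (`IsSmoothProjective.cyclesOfDim_ext_genericPoint`), and
   evaluation at `η` descends to an isomorphism `CH_n X = Z_n X / Rat_n X ≃+ ℤ` with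
   `[X] = primeCycle η ↦ 1` (`IsSmoothProjective.exists_chowGroup_top_equiv_apply_mk`,
   `IsSmoothProjective.exists_chowGroup_top_equiv_ofPoint`).

Irreducibility of `X.left` is carried as an instance argument `[IrreducibleSpace X.left]` in the
intermediate statements that mention the generic point (it follows from `IsSmoothProjective`,
see step 1, and is supplied in the final proofs).

## References

* W. Fulton, *Intersection Theory*, 2nd ed., Springer (1998), doi:10.1007/978-1-4612-1700-8:
  §1.3 (cycles, rational equivalence, `A_k X = Z_k X / Rat_k X`) and Example 1.3.2 (`A_n X = Z_n X`
  free on the `n`-dimensional components of an `n`-dimensional scheme). [Fulton1998]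
* U. Görtz, T. Wedhorn, *Algebraic Geometry I: Schemes*, 2nd ed. (2020): Lemma 5.7 (4),
  Lemma 6.26 (dimension of schemes smooth of relative dimension `n`). [GortzWedhorn2020]
-/

universe u

open CategoryTheory AlgebraicGeometry Order

noncomputable section

namespace Literature.AlgebraicGeometry.Motives

/-! ### Generic points in irreducible schemes -/

section GenericPoint

variable {X : Scheme.{u}}

/-- In an irreducible scheme every point is a specialisation of the generic point, i.e. lies below
it in the specialisation order (`a ≤ b ↔ b ⤳ a`). [folklore] -/
lemma le_genericPoint [IrreducibleSpace X] (z : X) : z ≤ genericPoint X :=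
  Scheme.le_iff_specializes.mpr (genericPoint_specializes z)

/-- In an irreducible scheme a point different from the generic point lies strictly below it in
the specialisation order (schemes are `T₀`). [folklore] -/
lemma lt_genericPoint [IrreducibleSpace X] {z : X} (hz : z ≠ genericPoint X) :
    z < genericPoint X := by
  refine lt_of_le_not_ge (le_genericPoint z) fun h ↦ hz ?_
  exact ((Scheme.le_iff_specializes.mp h).antisymm (genericPoint_specializes z)).eq

end GenericPoint

/-! ### Smooth projective varieties: the generic point is the unique point of top dimension -/

namespace IsSmoothProjective

variable {k : Type u} [Field k] {n : ℕ} {X : SchemeOver k}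

/-- For a smooth projective variety `X` of dimension `n`, the generic point `η` has height `n` in
the specialisation order, i.e. `dim X = dim closure {η} = n`: `height η` is the Krull dimension of
the specialisation order (`η` is its top), which is the topological Krull dimension (closed
irreducible subsets of the sober space `X` ↔ points, Mathlib `irreducibleSetEquivPoints`), which
is `n` (Görtz–Wedhorn I, Lemma 6.26 with Lemma 5.7 (4), through
`Literature.AlgebraicGeometry.Motives.topologicalKrullDim_eq_of_smoothOfRelativeDimension`).
[cite: GortzWedhorn2020, Lemma 6.26 and Lemma 5.7 (4)] -/
lemma height_genericPoint (h : IsSmoothProjective n X) [IrreducibleSpace X.left] :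
    height (genericPoint X.left) = n := by
  haveI := h.smoothOfRelativeDimension
  -- `height η = krullDim X` for the specialisation order
  have h1 : (height (genericPoint X.left) : WithBot ℕ∞) = krullDim ↥X.left := by
    refine le_antisymm (height_le_krullDim _) ?_
    rw [krullDim_eq_iSup_height_of_nonempty]
    exact WithBot.coe_le_coe.mpr (iSup_le fun a ↦ height_mono (le_genericPoint a))
  -- `krullDim X = topologicalKrullDim X = n`
  rw [← krullDim_eq_of_orderIso (irreducibleSetEquivPoints (α := ↥X.left)), ← topologicalKrullDim,
    topologicalKrullDim_eq_of_smoothOfRelativeDimension X.hom n] at h1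
  exact_mod_cast h1

/-- On a smooth projective variety of dimension `n` every point has height (= dimension of its
closure) at most `n`. [cite: GortzWedhorn2020, Lemma 6.26 and Lemma 5.7 (4)] -/
lemma height_le (h : IsSmoothProjective n X) (z : X.left) : height z ≤ n := by
  haveI := h.geometricallyIrreducible
  haveI : IrreducibleSpace X.left := GeometricallyIrreducible.irreducibleSpace_of_subsingleton X.hom
  rw [← h.height_genericPoint]
  exact height_mono (le_genericPoint z)

/-- On a smooth projective variety of dimension `n` no point has height `n + 1` (there is no
`(n + 1)`-dimensional closed subvariety). [cite: GortzWedhorn2020, Lemma 6.26 and Lemma 5.7 (4)] -/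
lemma height_ne_succ (h : IsSmoothProjective n X) (z : X.left) : height z ≠ n + 1 := by
  intro hz
  have := h.height_le z
  rw [hz] at this
  have h' : n + 1 ≤ n := by exact_mod_cast this
  omega

/-- On a smooth projective variety of dimension `n`, the points of height `n` (the
`n`-dimensional closed subvarieties) are exactly the generic point (i.e. `X` itself): any other
point `z` satisfies `height z + 1 ≤ height η = n`. [cite: Fulton1998, §1.3, Example 1.3.2] -/
lemma height_eq_iff (h : IsSmoothProjective n X) [IrreducibleSpace X.left] {z : X.left} :
    height z = n ↔ z = genericPoint X.left := by
  refine ⟨fun hz ↦ ?_, fun hz ↦ hz ▸ h.height_genericPoint⟩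
  by_contra hne
  have h1 := height_add_one_le (lt_genericPoint hne)
  rw [hz, h.height_genericPoint] at h1
  have h' : n + 1 ≤ n := by exact_mod_cast h1
  omega

/-! ### `Rat_n X = 0`, `Z_n X ≅ ℤ`, `CH_n X ≅ ℤ` -/

/-- **`Rat_n X = 0` for an `n`-dimensional variety** (Fulton, *Intersection Theory*, Example
1.3.2: a cycle `[div(r)]`, `r ∈ R(W)^*`, needs an `(n + 1)`-dimensional subvariety `W`, and
there is none). Here: the generators of `ratTrivial X.left n` require a closed subvariety `W`
with `W.dim = height W.genericPoint = n + 1`, excluded by `height_ne_succ`.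
[cite: Fulton1998, §1.3, Example 1.3.2] -/
lemma ratTrivial_eq_bot (h : IsSmoothProjective n X) : ratTrivial X.left n = ⊥ := by
  rw [ratTrivial, AddSubgroup.closure_eq_bot_iff]
  rintro c ⟨-, W, -, f, -, hW, -⟩
  exact (h.height_ne_succ W.genericPoint hW).elim

/-- On a smooth projective `n`-dimensional variety, two `n`-cycles with the same class in
`CH_n X` are equal (`Rat_n X = 0`; Fulton, Example 1.3.2: `A_n X = Z_n X`).
[cite: Fulton1998, §1.3, Example 1.3.2] -/
lemma chowGroup_mk_injective (h : IsSmoothProjective n X) :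
    Function.Injective (ChowGroup.mk X.left n) := by
  intro c c' hcc'
  have h1 := ChowGroup.mk_eq_mk_iff.mp hcc'
  rw [IsRationallyEquivalent, h.ratTrivial_eq_bot, AddSubgroup.mem_bot, sub_eq_zero] at h1
  exact Subtype.ext h1

/-- An `n`-cycle on a smooth projective `n`-dimensional variety vanishes away from the generic
point. [cite: Fulton1998, §1.3, Example 1.3.2] -/
lemma apply_eq_zero_of_ne_genericPoint (h : IsSmoothProjective n X) [IrreducibleSpace X.left]
    (c : ↥(cyclesOfDim X.left n)) {z : X.left} (hz : z ≠ genericPoint X.left) :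
    (c : AlgebraicCycle X.left ℤ) z = 0 := by
  by_contra hcz
  exact hz (h.height_eq_iff.mp (c.2 z hcz))

/-- **`Z_n X` is free on `[X]`**, injectivity half: an `n`-cycle on a smooth projective
`n`-dimensional variety is determined by its coefficient at the generic point (Fulton,
*Intersection Theory*, Example 1.3.2; the generic point is the only point of height `n`,
`height_eq_iff`). [cite: Fulton1998, §1.3, Example 1.3.2] -/
lemma cyclesOfDim_ext_genericPoint (h : IsSmoothProjective n X) [IrreducibleSpace X.left]
    {c c' : ↥(cyclesOfDim X.left n)}
    (hcc' : (c : AlgebraicCycle X.left ℤ) (genericPoint X.left) =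
      (c' : AlgebraicCycle X.left ℤ) (genericPoint X.left)) :
    c = c' := by
  refine Subtype.ext (Function.locallyFinsuppWithin.ext fun z ↦ ?_)
  by_cases hz : z = genericPoint X.left
  · subst hz
    exact hcc'
  · rw [h.apply_eq_zero_of_ne_genericPoint c hz, h.apply_eq_zero_of_ne_genericPoint c' hz]

/-- **`CH_n X = Z_n X ≅ ℤ` for a smooth projective `n`-dimensional variety** (Fulton,
*Intersection Theory*, §1.3, Example 1.3.2: `A_n X = Z_n X` is free on the `n`-dimensional
components, here the single component `[X]`). The isomorphism is *the coefficient of the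
fundamental class*: it sends the class `[c]` of an `n`-cycle `c` to its coefficient `c η` at the
generic point `η` (this determines it, `ChowGroup.mk_surjective`). Construction: evaluation at
`η` is additive, kills `Rat_n X = 0` (`ratTrivial_eq_bot`), is injective on `Z_n X`
(`cyclesOfDim_ext_genericPoint`) and takes the value `m` on `m • [X]`.
[cite: Fulton1998, §1.3, Example 1.3.2] -/
theorem exists_chowGroup_top_equiv_apply_mk (h : IsSmoothProjective n X) [IrreducibleSpace X.left] :
    ∃ e : ChowGroup X.left n ≃+ ℤ, ∀ c : ↥(cyclesOfDim X.left n),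
      e (ChowGroup.mk X.left n c) = (c : AlgebraicCycle X.left ℤ) (genericPoint X.left) := by
  -- evaluation at the generic point, `Z_n X →+ ℤ`
  let ev : ↥(cyclesOfDim X.left n) →+ ℤ :=
    { toFun := fun c ↦ (c : AlgebraicCycle X.left ℤ) (genericPoint X.left)
      map_zero' := rfl
      map_add' := fun _ _ ↦ rfl }
  -- it factors through `CH_n X = Z_n X / Rat_n X`, as `Rat_n X = 0`
  let φ : ChowGroup X.left n →+ ℤ :=
    QuotientAddGroup.lift _ ev fun c hc ↦ by
      rw [AddSubgroup.mem_addSubgroupOf, h.ratTrivial_eq_bot, AddSubgroup.mem_bot] at hc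
      rw [show c = 0 from Subtype.ext hc]
      exact (AddMonoidHom.mem_ker).mpr (map_zero ev)
  have hφ : ∀ c, φ (ChowGroup.mk X.left n c) = (c : AlgebraicCycle X.left ℤ) (genericPoint X.left) :=
    fun c ↦ rfl
  refine ⟨AddEquiv.ofBijective φ ⟨?_, ?_⟩, hφ⟩
  · -- injective: `[c] ↦ c η` has trivial kernel since `c` is supported on `{η}`
    refine (injective_iff_map_eq_zero _).mpr fun x hx ↦ ?_
    induction x using ChowGroup.induction_on with
    | h c =>
      rw [hφ] at hx
      rw [h.cyclesOfDim_ext_genericPoint (c := c) (c' := 0) (by simpa using hx), map_zero]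
  · -- surjective: `m • [X] ↦ m`
    intro m
    refine ⟨m • ChowGroup.ofPoint (genericPoint X.left) h.height_genericPoint, ?_⟩
    rw [map_zsmul, ChowGroup.ofPoint, hφ, primeCycle_apply_self, smul_eq_mul, mul_one]

/-- The isomorphism `CH_n X ≅ ℤ` normalised by the fundamental class: there is `e : CH_n X ≃+ ℤ`
with `e [V] = 1` for every `n`-dimensional point `V` — necessarily the generic point, `[V] = [X]`
(`height_eq_iff`); `X` is irreducible, being geometrically irreducible over the point `Spec k`
(Mathlib `GeometricallyIrreducible.irreducibleSpace_of_subsingleton`).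
[cite: Fulton1998, §1.3, Example 1.3.2] -/
theorem exists_chowGroup_top_equiv_ofPoint (h : IsSmoothProjective n X) :
    ∃ e : ChowGroup X.left n ≃+ ℤ,
      ∀ (z : X.left) (hz : height z = n), e (ChowGroup.ofPoint z hz) = 1 := by
  haveI := h.geometricallyIrreducible
  haveI : IrreducibleSpace X.left := GeometricallyIrreducible.irreducibleSpace_of_subsingleton X.hom
  obtain ⟨e, he⟩ := h.exists_chowGroup_top_equiv_apply_mk
  refine ⟨e, fun z hz ↦ ?_⟩
  obtain rfl := h.height_eq_iff.mp hz
  rw [ChowGroup.ofPoint, he]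
  exact primeCycle_apply_self _

end IsSmoothProjective

end Literature.AlgebraicGeometry.Motives

/-! ### Discharge of the named facts -/

namespace Literature.AlgebraicGeometry.Motives

variable {k : Type u} [Field k]

/-- **Discharge of `Literature.AlgebraicGeometry.Motives.exists_chowGroup_top_equiv_int`** (hodge.S10; Fulton,
*Intersection Theory*, §1.3, Example 1.3.2: for an `n`-dimensional variety `A_n X = Z_n X` is free
on `[X]`). For a smooth projective geometrically integral `n`-fold `X` over a field there is an
isomorphism `CH_n X ≃+ ℤ` (the coefficient of the fundamental class,
`Literature.AlgebraicGeometry.Motives.IsSmoothProjective.exists_chowGroup_top_equiv_apply_mk`) sending the class of every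
`n`-dimensional point — i.e. `[X]` — to `1`. [cite: Fulton1998, §1.3, Example 1.3.2] -/
theorem exists_chowGroup_top_equiv_int_holds : exists_chowGroup_top_equiv_int (k := k) :=
  fun h ↦ h.exists_chowGroup_top_equiv_ofPoint

/-- **Discharge of `Literature.AlgebraicGeometry.Motives.nonempty_chowGroup_top_equiv_int`** (hodge.S10; Fulton,
*Intersection Theory*, §1.3, Example 1.3.2): `CH_n X ≅ ℤ` for a smooth projective geometrically
integral `n`-fold over a field. [cite: Fulton1998, §1.3, Example 1.3.2] -/
theorem nonempty_chowGroup_top_equiv_int_holds : nonempty_chowGroup_top_equiv_int (k := k) :=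
  fun h ↦ (exists_chowGroup_top_equiv_int_holds h).nonempty

end Literature.AlgebraicGeometry.Motives

end
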